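import Mathlib
import Summits.NavierStokesRegularity.NavierStokesRegularity.Theorems.FilamentSkeletonRssSkeletonJ1RLiaLipschitzTools
import Summits.NavierStokesRegularity.NavierStokesRegularity.Theorems.FilamentSkeletonRssSkeletonJ1RLiaReference
import Summits.NavierStokesRegularity.NavierStokesRegularity.Theorems.FilamentSkeletonRssSkeletonJ1RLiaGeometry

/-!
# Crux `SkeletonJ1R` (stmt-NavierStokesRegularity-23610) · line `streamline_kantorovich_R` · toward stub F2-d (`LiaDefectDerivBL`, v7), brick of S4′ for B1′:
# THE DERIVATIVE OF THE AMBIENT FIELD IS BOUNDED BY `Σ|Γγ_k/4π|·24/d² + (½+|α|)` at perpendicular distance `≥ d` from the partner datum lines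

Hand `leafhand-ns-filamentskeletonrs-1` (gen 0), `--supports stmt-NavierStokesRegularity-23610 --as helper`.  MODEL rung, NEGATIVE side of the ladder:
calculus for a HYPOTHETICAL filament-type blow-up skeleton; nothing here is a claim about Navier–Stokes regularity; the stub and the crux stay OPEN.

`norm_fderiv_ambientField_le` — the operator norm of `DW_j(y)` (`W_j = ambientField`, `C^∞` by `…LiaReference.contDiff_ambientField`) at a point `y` whose
perpendicular distance from every partner datum line is `≥ d > 0` is at most `Σ_{k≠j}|Γγ_k/4π|·(6/(d/2)²) + (½+|α|)`: the two-point Lipschitz bound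
`…LiaLipschitzTools.norm_ambientField_sub_le` on the ball `‖z − y‖ < d/2` (where the perpendicular distances are `≥ d/2`, `perpDist_ge_of_near`) and Mathlib's
`HasFDerivAt.le_of_lip'`.  This is the `‖DW‖` input of the bound `H` on `x‴` (`…LiaThirdDerivative.IsLiaReference.norm_thirdDeriv_le`) in S4′.
-/

set_option linter.dupNamespace false -- `NavierStokesRegularity.NavierStokesRegularity` path/namespace repetition is the tree convention

noncomputable section

namespace Summit.NavierStokesRegularity.NavierStokesRegularity.Theorems.SkeletonJ1RFrame

open Set Function Filter MeasureTheory Real Topology Metric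
open Literature.Analysis.FluidPDE
open scoped InnerProductSpace BigOperators

/-- Perpendicular distance is `1`-Lipschitz: if `d² ≤ ‖y − w‖² − ⟪y − w, t⟫²` (`‖t‖ = 1`, `d > 0`) and `‖z − y‖ ≤ d/2` then
`(d/2)² ≤ ‖z − w‖² − ⟪z − w, t⟫²`. [folklore] -/
theorem perpDist_ge_of_near {d : ℝ} (hd : 0 < d) {t w y z : EuclideanSpace ℝ (Fin 3)} (ht : ‖t‖ = 1)
    (hy : d ^ 2 ≤ ‖y - w‖ ^ 2 - (inner ℝ (y - w) t) ^ 2) (hz : ‖z - y‖ ≤ d / 2) :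
    (d / 2) ^ 2 ≤ ‖z - w‖ ^ 2 - (inner ℝ (z - w) t) ^ 2 := by
  -- perpendicular components
  set Py := (y - w) - (inner ℝ (y - w) t) • t with hPy
  set Pz := (z - w) - (inner ℝ (z - w) t) • t with hPz
  have hPy2 : ‖Py‖ ^ 2 = ‖y - w‖ ^ 2 - (inner ℝ (y - w) t) ^ 2 := norm_perpTo_sq t (y - w) ht
  have hPz2 : ‖Pz‖ ^ 2 = ‖z - w‖ ^ 2 - (inner ℝ (z - w) t) ^ 2 := norm_perpTo_sq t (z - w) ht
  have hdiff : Pz - Py = (z - y) - (inner ℝ (z - y) t) • t := by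
    have : z - w = (z - y) + (y - w) := by abel
    rw [hPz, hPy, this, inner_add_left, add_smul]; abel
  have hdn : ‖Pz - Py‖ ≤ d / 2 := by rw [hdiff]; exact (norm_perpTo_le t (z - y) ht).trans hz
  have hPyd : d ≤ ‖Py‖ := by
    have h := Real.sqrt_le_sqrt hy
    rw [← hPy2, Real.sqrt_sq hd.le, Real.sqrt_sq (norm_nonneg _)] at h
    exact h
  have hPzd : d / 2 ≤ ‖Pz‖ := by
    have h := norm_sub_norm_le Py Pz
    rw [norm_sub_rev] at hdn
    have : ‖Py‖ - ‖Pz‖ ≤ ‖Py - Pz‖ := by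
      have := abs_norm_sub_norm_le Py Pz; exact (le_abs_self _).trans this
    linarith
  rw [← hPz2]
  exact pow_le_pow_left₀ (by positivity) hPzd 2

/-- **`‖DW_j(y)‖ ≤ Σ_{k≠j}|Γγ_k/4π|·(6/(d/2)²) + (½+|α|)`** at perpendicular distance `≥ d` from every partner datum line. [folklore] -/
theorem norm_fderiv_ambientField_le {N : ℕ} (Γ : ℝ) (p t : Fin N → EuclideanSpace ℝ (Fin 3)) (γ : Fin N → ℝ) (α : ℝ) (s₀ : Fin N → ℝ)
    (ht : ∀ k, ‖t k‖ = 1) (j : Fin N) {d : ℝ} (hd : 0 < d) {y : EuclideanSpace ℝ (Fin 3)}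
    (hfar : ∀ k, k ≠ j → d ^ 2 ≤ ‖y - waistPt Γ p t s₀ k‖ ^ 2 - (inner ℝ (y - waistPt Γ p t s₀ k) (t k)) ^ 2) :
    ‖fderiv ℝ (ambientField Γ p t γ α s₀ j) y‖ ≤ (∑ k ∈ Finset.univ.erase j, |Γ*γ k/(4*Real.pi)| * (6 / (d / 2) ^ 2)) + (1/2 + |α|) := by
  have hWd : Differentiable ℝ (ambientField Γ p t γ α s₀ j) :=
    (contDiff_ambientField Γ p t γ α s₀ ht j (n := 1)).differentiable one_ne_zero
  have hd2 : 0 < d / 2 := by positivity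
  have hC0 : 0 ≤ (∑ k ∈ Finset.univ.erase j, |Γ*γ k/(4*Real.pi)| * (6 / (d / 2) ^ 2)) + (1/2 + |α|) := by positivity
  refine (hWd y).hasFDerivAt.le_of_lip' hC0 ?_
  have hball : ∀ᶠ z in 𝓝 y, ‖z - y‖ ≤ d / 2 := by
    have h : Metric.closedBall y (d / 2) ∈ 𝓝 y := Metric.closedBall_mem_nhds y hd2
    filter_upwards [h] with z hz
    rwa [Metric.mem_closedBall, dist_eq_norm] at hz
  filter_upwards [hball] with z hz
  have hfz : ∀ k, k ≠ j → (d / 2) ^ 2 ≤ ‖z - waistPt Γ p t s₀ k‖ ^ 2 - (inner ℝ (z - waistPt Γ p t s₀ k) (t k)) ^ 2 :=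
    fun k hk => perpDist_ge_of_near hd (ht k) (hfar k hk) hz
  have hfy : ∀ k, k ≠ j → (d / 2) ^ 2 ≤ ‖y - waistPt Γ p t s₀ k‖ ^ 2 - (inner ℝ (y - waistPt Γ p t s₀ k) (t k)) ^ 2 :=
    fun k hk => (by nlinarith [hd] : (d / 2) ^ 2 ≤ d ^ 2).trans (hfar k hk)
  exact norm_ambientField_sub_le Γ p t γ α s₀ ht j hd2 hfz hfy

end Summit.NavierStokesRegularity.NavierStokesRegularity.Theorems.SkeletonJ1RFrame

end
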